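import Summits.ResolutionOfSingularities.ResolutionOfSingularities.Theorems.HilbertSamuelEliminationSigmaMaxModificationsCorridor3WLadderIsoInsepCellsDefs
import Literature.AlgebraicGeometry.Resolution.NagataJacobianCriterion
import Literature.RingTheory.MvPowerSeries.MaximalIdealPow
import HarnessLib

/-!
# [OURS · L1 W4.2] k2 row S-fin₂, ALGEBRA half, part 1/2: the `λ`-part over a field of 2-rank one and the JACOBIAN ROW of
# `x² + λy² + g(z,w)` (crux chain w42, cell k2 `T3insep`, `--supports stmt-…-19249`)

OURS (cell res-hironaka, slot W4.2, seat res-D-pv-042; res-L1-w42-plan-1 RULING v3.14-16a (EU), CUT 12:02:38Z); NOT a statement of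
[Hironaka2017] nor of [CossartJannsenSaito2020] / [Matsumura1987]. AI-drafted, weaker than expert review. HELPER file: no row is closed
here; it is the pure commutative algebra behind `IdeasL1C6.SplitMilnorFinite₂` (k2 PART 2′, `…Corridor3WLadderIsoInsepCellsDefs`),
split in two files by the 400-line rule: THIS file = §1–§2; `…IsoInsepSplitMilnorAlgebra` = §3–§4.

Setting: `κ` a field of characteristic `2` of 2-rank one presented by `λ` (`λ ∉ κ²`, `κ = κ² + λκ²` — the `hpb` clause of
`IsPBSplitInsepAt`), `g ∈ κ⟦z,w⟧` without constant and linear terms, `F = splitEq 2 λ g = x² + λy² + g(z,w) ∈ S = κ⟦x,y,z,w⟧`.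

* §1 `lamSqPart` — under `hpb` every `c ∈ κ` is `a² + λb²` with `b²` UNIQUE (`λ ∉ κ²`); every derivation `D ∈ Der(κ)` kills squares
  (characteristic two), so `D c = D(λ)·b²` (`derivation_apply_eq_mul_lamSqPart`).  Coefficientwise: `lamPart g` and
  `coeffDerivation D g = D(λ) • lamPart g`.
* §2 the JACOBIAN ROW of `F`: `∂_x F = ∂_y F = 0`, `∂_z F, ∂_w F` = the renamed `g_z, g_w`, and `D̃ F = D(λ)·(y² + lamPart g)` for EVERY
  `D ∈ Der(κ)` — so the whole row lies in the ideal `𝔍 = (g_z, g_w, y² + lamPart g) S`, independently of `D`.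
* §3 THE PRIME: if the Milnor algebra `κ⟦z,w⟧/(g_z, g_w)` is NOT finite over `κ`, then `Λ := κ⟦z,w⟧/(g_z, g_w)` has Krull dimension
  `≥ 1` (a zero-dimensional quotient contains a power of `𝔪` and is finite), and reading `S = (κ⟦z,w⟧)⟦x,y⟧`
  (`Literature.RingTheory.MvPowerSeries.SumEquiv.sumAlgEquiv`, Zariski–Samuel II Ch. VII §1) the surjection `Θ : S ↠ Λ⟦x,y⟧` sends `F` into
  `I = (x² + ā′, y² + b̄′)` (`b′ = lamPart g`, `a′ = g + λb′`; characteristic two); Krull's height theorem over the local ring `Λ`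
  (`relPowerSeries_le_ringKrullDim_quotient_add_spanFinrank`: `dim Λ + 2 ≤ dim Λ⟦x,y⟧/I + μ(I)`) gives `dim Λ⟦x,y⟧/I ≥ 1`, hence a
  NON-MAXIMAL prime `𝔓 ⊇ I`, and `P = Θ⁻¹𝔓` is a non-maximal prime of `S` containing `F` and its whole Jacobian row
  (`exists_prime_jacobian_vanishes_of_not_finite`).
* §4 CONCLUSION `moduleFinite_milnorAlg_of_jacobian`: if at every non-maximal prime `P ∋ F` some entry of the Jacobian row is NOT in
  `P` (the output shape of Nagata's criterion, `Literature.AlgebraicGeometry.Resolution.Matsumura1987_30_10_hypersurface`, fed by the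
  REGULARITY of `S_P/(F)` which the scheme side derives from isolation — file `…IsoInsepSplitMilnorFinite`), then
  `Module.Finite κ (MilnorAlg g)`.

References (pointers only): [Matsumura1987, Thm. 30.10, Thm. 13.5/13.6]; W4.1 `WildCones.MuDropCharTwoOrdP` (the Milnor algebra carrier).
-/

noncomputable section

set_option linter.dupNamespace false

open scoped Classical
open MvPowerSeries IsLocalRing
open Literature.AlgebraicGeometry.Resolution

namespace Summit.ResolutionOfSingularities.ResolutionOfSingularities.Cruxes.SigmaMaxModifications.IdeasL1C6

/-! ## §1. The `λ`-part of an element and of a series over a field of 2-rank one -/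

section LamPart

variable {κ : Type} [Field κ]

/-- In characteristic two a derivation kills squares: `D(a²) = 2a·Da = 0`. [folklore] -/
theorem derivation_apply_sq [CharP κ 2] (D : Derivation ℤ κ κ) (a : κ) : D (a ^ 2) = 0 := by
  rw [pow_two, D.leibniz, smul_eq_mul, CharTwo.add_self_eq_zero]

/-- Uniqueness of the `λ`-coordinate: `a² + λb² = a'² + λb'²` with `λ ∉ κ²` forces `b = b'` (characteristic two). [folklore] -/
theorem eq_of_sq_add_mul_sq_eq [CharP κ 2] {lam : κ} (hlam : ∀ c : κ, c ^ 2 ≠ lam) {a b a' b' : κ}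
    (h : a ^ 2 + lam * b ^ 2 = a' ^ 2 + lam * b' ^ 2) : b = b' := by
  by_contra hne
  have hb : b + b' ≠ 0 := fun h0 => hne (CharTwo.add_eq_zero.mp h0)
  -- `(a + a')² = λ (b + b')²`
  have h1 : (a + a') ^ 2 = lam * (b + b') ^ 2 := by
    have e1 : (a + a') ^ 2 = a ^ 2 + a' ^ 2 := CharTwo.add_sq a a'
    have e2 : (b + b') ^ 2 = b ^ 2 + b' ^ 2 := CharTwo.add_sq b b'
    rw [e1, e2]
    have h' := h
    -- move everything to one side using `x = -x`
    have : a ^ 2 + a' ^ 2 = lam * b ^ 2 + lam * b' ^ 2 := by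
      have e3 : a ^ 2 = a' ^ 2 + lam * b' ^ 2 + lam * b ^ 2 := by
        rw [← h']; rw [add_assoc, CharTwo.add_self_eq_zero, add_zero]
      rw [e3]; ring_nf
      rw [show a' ^ 2 * 2 = 0 from by rw [mul_comm, two_mul, CharTwo.add_self_eq_zero], zero_add, add_comm]
    rw [this, mul_add]
  apply hlam ((a + a') / (b + b'))
  rw [div_pow, h1, mul_div_assoc, div_self (pow_ne_zero 2 hb), mul_one]

/-- The **`λ`-square-part** of `c ∈ κ` for a field of 2-rank one presented by `λ` (`hpb : ∀ c, ∃ a b, c = a² + λb²`): the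
(unique) `b²`. [folklore] -/
def lamSqPart (lam : κ) (hpb : ∀ c : κ, ∃ a b : κ, c = a ^ 2 + lam * b ^ 2) (c : κ) : κ :=
  (Classical.choose (Classical.choose_spec (hpb c))) ^ 2

/-- The defining decomposition `c = a² + λ · lamSqPart c`. [folklore] -/
theorem exists_eq_sq_add_mul_lamSqPart (lam : κ) (hpb : ∀ c : κ, ∃ a b : κ, c = a ^ 2 + lam * b ^ 2) (c : κ) :
    ∃ a : κ, c = a ^ 2 + lam * lamSqPart lam hpb c :=
  ⟨Classical.choose (hpb c), Classical.choose_spec (Classical.choose_spec (hpb c))⟩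

/-- `lamSqPart` of an explicit decomposition. [folklore] -/
theorem lamSqPart_eq [CharP κ 2] {lam : κ} (hlam : ∀ c : κ, c ^ 2 ≠ lam) (hpb : ∀ c : κ, ∃ a b : κ, c = a ^ 2 + lam * b ^ 2)
    {a b : κ} : lamSqPart lam hpb (a ^ 2 + lam * b ^ 2) = b ^ 2 := by
  obtain ⟨a', ha'⟩ := exists_eq_sq_add_mul_lamSqPart lam hpb (a ^ 2 + lam * b ^ 2)
  unfold lamSqPart at ha' ⊢
  have := eq_of_sq_add_mul_sq_eq hlam ha'
  rw [← this]

/-- `lamSqPart 0 = 0`. [folklore] -/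
theorem lamSqPart_zero [CharP κ 2] {lam : κ} (hlam : ∀ c : κ, c ^ 2 ≠ lam) (hpb : ∀ c : κ, ∃ a b : κ, c = a ^ 2 + lam * b ^ 2) :
    lamSqPart lam hpb 0 = 0 := by
  have h := lamSqPart_eq hlam hpb (a := 0) (b := 0)
  simpa using h

/-- **Every derivation of `κ` is `D(λ)` times «the `λ`-derivative»**: `D c = D λ · lamSqPart c`. [folklore] -/
theorem derivation_apply_eq_mul_lamSqPart [CharP κ 2] {lam : κ} (hpb : ∀ c : κ, ∃ a b : κ, c = a ^ 2 + lam * b ^ 2)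
    (D : Derivation ℤ κ κ) (c : κ) : D c = D lam * lamSqPart lam hpb c := by
  obtain ⟨a, ha⟩ := exists_eq_sq_add_mul_lamSqPart lam hpb c
  have hs : D (lamSqPart lam hpb c) = 0 := derivation_apply_sq D _
  conv_lhs => rw [ha]
  rw [map_add, derivation_apply_sq, zero_add, D.leibniz, smul_eq_mul, smul_eq_mul, hs, mul_zero, zero_add, mul_comm]

variable {σ : Type*}

/-- The coefficientwise `λ`-square-part of a series: `lamPart g := Σ_e lamSqPart(g_e) X^e`. [folklore] -/
def lamPart (lam : κ) (hpb : ∀ c : κ, ∃ a b : κ, c = a ^ 2 + lam * b ^ 2) (g : MvPowerSeries σ κ) : MvPowerSeries σ κ :=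
  MvPowerSeries.coeffMapFun (lamSqPart lam hpb) g

/-- Coefficients of `lamPart`. [folklore] -/
@[simp] theorem coeff_lamPart (lam : κ) (hpb : ∀ c : κ, ∃ a b : κ, c = a ^ 2 + lam * b ^ 2) (g : MvPowerSeries σ κ)
    (e : σ →₀ ℕ) : coeff e (lamPart lam hpb g) = lamSqPart lam hpb (coeff e g) := rfl

/-- **`D̃ g = D(λ) • lamPart g`** for every `D ∈ Der(κ)` (coefficientwise `derivation_apply_eq_mul_lamSqPart`). [folklore] -/
theorem coeffDerivation_eq_smul_lamPart [CharP κ 2] {lam : κ} (hpb : ∀ c : κ, ∃ a b : κ, c = a ^ 2 + lam * b ^ 2)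
    (D : Derivation ℤ κ κ) (g : MvPowerSeries σ κ) :
    MvPowerSeries.coeffDerivation D g = D lam • lamPart lam hpb g := by
  ext e
  rw [MvPowerSeries.coeff_coeffDerivation, map_smul, coeff_lamPart, smul_eq_mul,
    derivation_apply_eq_mul_lamSqPart hpb]

/-- `lamPart g` has no constant term when `g` has none. [folklore] -/
theorem constantCoeff_lamPart [CharP κ 2] {lam : κ} (hlam : ∀ c : κ, c ^ 2 ≠ lam) (hpb : ∀ c : κ, ∃ a b : κ, c = a ^ 2 + lam * b ^ 2)
    {g : MvPowerSeries σ κ} (hg : constantCoeff g = 0) : constantCoeff (lamPart lam hpb g) = 0 := by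
  rw [← coeff_zero_eq_constantCoeff_apply, coeff_lamPart, coeff_zero_eq_constantCoeff_apply, hg, lamSqPart_zero hlam hpb]

end LamPart

/-! ## §2. The Jacobian row of `F = x² + λy² + g(z,w)` -/

section JacobianRow

variable {κ : Type} [Field κ]

/-- `D̃ (C c) = C (D c)`. [folklore] -/
theorem coeffDerivation_C {σ : Type*} (D : Derivation ℤ κ κ) (c : κ) :
    MvPowerSeries.coeffDerivation D (C c : MvPowerSeries σ κ) = C (D c) := by
  ext e
  rw [MvPowerSeries.coeff_coeffDerivation, coeff_C, coeff_C]
  split_ifs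
  · rfl
  · exact map_zero D

/-- `D̃` kills monomials with coefficient one, in particular powers of variables. [folklore] -/
theorem coeffDerivation_X_pow {σ : Type*} (D : Derivation ℤ κ κ) (s : σ) (n : ℕ) :
    MvPowerSeries.coeffDerivation D ((X s : MvPowerSeries σ κ) ^ n) = 0 := by
  ext e
  rw [MvPowerSeries.coeff_coeffDerivation, coeff_X_pow, coeff_zero]
  split_ifs
  · exact D.map_one_eq_zero
  · exact map_zero D

/-- `D̃` commutes with renaming along a map with finite fibres (coefficients of `rename f g` are finite sums of coefficients of `g`).
[folklore] -/
theorem coeffDerivation_rename {σ τ : Type*} (f : σ → τ) [Filter.TendstoCofinite f] (D : Derivation ℤ κ κ)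
    (g : MvPowerSeries σ κ) :
    MvPowerSeries.coeffDerivation D (rename f g) = rename f (MvPowerSeries.coeffDerivation D g) := by
  ext e
  rw [MvPowerSeries.coeff_coeffDerivation, coeff_rename, coeff_rename, map_sum]
  rfl

/-- The partial derivatives of a series renamed into the LAST two of four variables: in the first two directions they vanish, in
the last two they are the renamed partial derivatives. [folklore] -/
theorem pderiv_rename_natAdd (g : MvPowerSeries (Fin 2) κ) (s : Fin 4) :
    MvPowerSeries.pderiv s (rename (Fin.natAdd 2) g) =
      if h : ∃ j : Fin 2, Fin.natAdd 2 j = s then rename (Fin.natAdd 2) (MvPowerSeries.pderiv (Classical.choose h) g) else 0 := by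
  have hX : (X ∘ Fin.natAdd 2 : Fin 2 → MvPowerSeries (Fin 4) κ) = fun t => X (Fin.natAdd 2 t) := rfl
  rw [rename_eq_subst, hX, MvPowerSeries.pderiv_subst (fun t => constantCoeff_X _) s]
  split_ifs with h
  · obtain ⟨j, hj⟩ := h
    have hj' : Classical.choose (⟨j, hj⟩ : ∃ j : Fin 2, Fin.natAdd 2 j = s) = j :=
      Fin.natAdd_injective 2 _ (by rw [Classical.choose_spec (⟨j, hj⟩ : ∃ j : Fin 2, Fin.natAdd 2 j = s), hj])
    rw [hj', Finset.sum_eq_single j]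
    · rw [MvPowerSeries.pderiv_X, hj, if_pos rfl, mul_one, ← hX, ← rename_eq_subst]
    · intro t _ ht
      rw [MvPowerSeries.pderiv_X, if_neg, mul_zero]
      intro hts
      exact ht (Fin.natAdd_injective 2 _ (hts.trans hj.symm))
    · intro hj0; exact absurd (Finset.mem_univ j) hj0
  · apply Finset.sum_eq_zero
    intro t _
    rw [MvPowerSeries.pderiv_X, if_neg, mul_zero]
    intro hts
    exact h ⟨t, hts⟩

/-- `∂_{x}`, `∂_{y}` of `F = splitEq 2 λ g` vanish (characteristic two). [folklore] -/
theorem pderiv_splitEq_castAdd [CharP κ 2] (lam : κ) (g : MvPowerSeries (Fin 2) κ) (i : Fin 2) :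
    MvPowerSeries.pderiv (Fin.castAdd 2 i) (splitEq 2 lam g) = 0 := by
  unfold splitEq
  rw [map_add, map_add, pderiv_rename_natAdd, dif_neg]
  · have h0 : MvPowerSeries.pderiv (Fin.castAdd 2 i) ((X 0 : MvPowerSeries (Fin 4) κ) ^ 2) = 0 := by
      have := Summit.ResolutionOfSingularities.ResolutionOfSingularities.Theorems.WildCones.MuDropCharTwoOrdP.pderiv_X_sq_mul
        (Fin.castAdd 2 i) (0 : Fin 4) (1 : MvPowerSeries (Fin 4) κ)
      rw [mul_one] at this
      rw [this]
      have h1 : MvPowerSeries.pderiv (Fin.castAdd 2 i) (1 : MvPowerSeries (Fin 4) κ) = 0 :=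
        (MvPowerSeries.pderiv (Fin.castAdd 2 i)).map_one_eq_zero
      rw [h1, mul_zero]
    have h1 : MvPowerSeries.pderiv (Fin.castAdd 2 i) (C lam * (X 1 : MvPowerSeries (Fin 4) κ) ^ 2) = 0 := by
      have := Summit.ResolutionOfSingularities.ResolutionOfSingularities.Theorems.WildCones.MuDropCharTwoOrdP.pderiv_X_sq_mul
        (Fin.castAdd 2 i) (1 : Fin 4) (C lam : MvPowerSeries (Fin 4) κ)
      rw [mul_comm] at this
      rw [this, MvPowerSeries.pderiv_C, mul_zero]
    rw [h0, h1, zero_add, zero_add]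
  · rintro ⟨j, hj⟩
    have := congrArg Fin.val hj
    simp [Fin.natAdd, Fin.castAdd] at this
    omega

/-- `∂_{z}`, `∂_{w}` of `F = splitEq 2 λ g` are the renamed `g_z`, `g_w`. [folklore] -/
theorem pderiv_splitEq_natAdd [CharP κ 2] (lam : κ) (g : MvPowerSeries (Fin 2) κ) (j : Fin 2) :
    MvPowerSeries.pderiv (Fin.natAdd 2 j) (splitEq 2 lam g) = rename (Fin.natAdd 2) (MvPowerSeries.pderiv j g) := by
  unfold splitEq
  rw [map_add, map_add, pderiv_rename_natAdd, dif_pos ⟨j, rfl⟩]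
  have hj : Classical.choose (⟨j, rfl⟩ : ∃ j' : Fin 2, Fin.natAdd 2 j' = Fin.natAdd 2 j) = j :=
    Fin.natAdd_injective 2 _ (Classical.choose_spec (⟨j, rfl⟩ : ∃ j' : Fin 2, Fin.natAdd 2 j' = Fin.natAdd 2 j))
  rw [hj]
  have h0 : MvPowerSeries.pderiv (Fin.natAdd 2 j) ((X 0 : MvPowerSeries (Fin 4) κ) ^ 2) = 0 := by
    have := Summit.ResolutionOfSingularities.ResolutionOfSingularities.Theorems.WildCones.MuDropCharTwoOrdP.pderiv_X_sq_mul
      (Fin.natAdd 2 j) (0 : Fin 4) (1 : MvPowerSeries (Fin 4) κ)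
    rw [mul_one] at this
    rw [this, (MvPowerSeries.pderiv (Fin.natAdd 2 j)).map_one_eq_zero, mul_zero]
  have h1 : MvPowerSeries.pderiv (Fin.natAdd 2 j) (C lam * (X 1 : MvPowerSeries (Fin 4) κ) ^ 2) = 0 := by
    have := Summit.ResolutionOfSingularities.ResolutionOfSingularities.Theorems.WildCones.MuDropCharTwoOrdP.pderiv_X_sq_mul
      (Fin.natAdd 2 j) (1 : Fin 4) (C lam : MvPowerSeries (Fin 4) κ)
    rw [mul_comm] at this
    rw [this, MvPowerSeries.pderiv_C, mul_zero]
  rw [h0, h1, zero_add, zero_add]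

/-- **Every coefficient derivation of `F` is a multiple of ONE element**: `D̃ F = D(λ) • (y² + lamPart g)` (renamed). [folklore] -/
theorem coeffDerivation_splitEq [CharP κ 2] {lam : κ} (hpb : ∀ c : κ, ∃ a b : κ, c = a ^ 2 + lam * b ^ 2) (D : Derivation ℤ κ κ)
    (g : MvPowerSeries (Fin 2) κ) :
    MvPowerSeries.coeffDerivation D (splitEq 2 lam g) =
      D lam • ((X 1 : MvPowerSeries (Fin 4) κ) ^ 2 + rename (Fin.natAdd 2) (lamPart lam hpb g)) := by
  unfold splitEq
  rw [map_add, map_add, coeffDerivation_X_pow, zero_add, (MvPowerSeries.coeffDerivation D).leibniz, coeffDerivation_X_pow,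
    smul_zero, zero_add, coeffDerivation_C, coeffDerivation_rename, coeffDerivation_eq_smul_lamPart hpb, smul_add,
    map_smul, smul_eq_mul, Algebra.smul_def, Algebra.smul_def, MvPowerSeries.algebraMap_apply, Algebra.algebraMap_self,
    RingHom.id_apply, mul_comm]

end JacobianRow

end Summit.ResolutionOfSingularities.ResolutionOfSingularities.Cruxes.SigmaMaxModifications.IdeasL1C6

end
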